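import Summits.BirchSwinnertonDyer.BirchSwinnertonDyer.Theorems.ShaPrimaryTransferFiniteShaComponentTransferSelmerCubicDRow
import HarnessLib

/-!
# BirchSwinnertonDyer — SEL2CUBIC doors for the dyadic-root-view two-auxiliary-prime census rows (`checkCD r`): the `K`-free row shapes and the row kit

HONEST FRAMING: route `ShaPrimaryTransfer`, seat `bsd-line-spt-p1` (g31), `--supports` item T =
`FiniteShaComponentTransfer` (stmt-22356), UNCHANGED (conjecture-grade at corank ≥ 2). BSD in rank ≥ 2 is NOT
proved by any of this. THEOREMS ONLY.

The door `sha_door_of_checkCD` (`…SelmerCubicDRow`) over the abstract cubic field `CubicField a b c`, in the exact argument shapes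
of the 88 census rows `rank_eq_of_certsD{,_scaled,_complSq,_plain}` in `TwoDescClOmegaD{,R3}Rows*` (77 of them rank-3 rows with an EMPTY kill list), so that each row with residue-certifiable kills (in particular every row with an EMPTY kill list) becomes
an unconditional `t₂(E) = 0 ∧ Ш(E/ℚ)[2^∞] = 0 ∧ rank E(ℚ) = r` theorem by swapping the theorem name (g30 recipe, HOME
`SEL2CUBIC-g30-data/README.md` §2): `sha_door_of_certsD`, `shaCorank_two_eq_zero_of_certsD_scaled`,
`shaCorank_two_eq_zero_of_certsD_complSq`, `sha_door_of_certsD_plain`, and the row kit `killResidueD_nil` /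
`killResidueD_cons` / `killResidueD_cons_z` (replacing `killValid…_nil/_cons/_cons_z`; a residue certificate
`killResidue_of_<shape> … (by decide +kernel)` replaces `killValidAt_of_<shape>`; the validity-only certificates
`qkCert_sound` / `conicCert_sound` have no residue form here). Transport along the models: `…SelmerCubicDoorTransport`.
[cite: Cassels1991LecturesEllipticCurves, §15] [cite: SilvermanAEC2009, Thm. X.4.2, Rem. X.4.1]
[cite: CremonaAlgorithms1997, §3.6]
-/

-- single-conjunct summit: `Summit.BirchSwinnertonDyer.BirchSwinnertonDyer.…` repeats the name by design
set_option linter.dupNamespace false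

noncomputable section

open scoped Classical

open Literature.NumberTheory.NumberFields Literature.NumberTheory.EllipticCurves WeierstrassCurve

namespace Summit.BirchSwinnertonDyer.BirchSwinnertonDyer.Theorems.ShaPrimaryTransferSelmerCubicCover

open Summit.BirchSwinnertonDyer.BirchSwinnertonDyer.Rank2Observatory
open Summit.BirchSwinnertonDyer.BirchSwinnertonDyer.Rank2Observatory.TwoDescCubic
open Summit.BirchSwinnertonDyer.BirchSwinnertonDyer.Rank2Observatory.TwoDescCl
open Summit.BirchSwinnertonDyer.BirchSwinnertonDyer.Rank2Observatory.TwoDescKill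

section Kit

variable {F : ClFieldCertDc} {cc : ClCurveCertD}

/-- The kill hypothesis of the empty kill list. [folklore] -/
theorem killResidueD_nil :
    ∀ k ∈ ([] : List ClKill), k.p.Prime ∧ ∃ N : ℕ, ∀ v : ℤ × ℤ × ℤ × ℤ,
      ¬ ((k.p : ℤ) ∣ v.1 ∧ (k.p : ℤ) ∣ v.2.1 ∧ (k.p : ℤ) ∣ v.2.2.1 ∧ (k.p : ℤ) ∣ v.2.2.2) →
      (k.p : ℤ) ^ N ∣ (killQ F.fd.base.a F.fd.base.b F.fd.base.c (k.zD F cc) cc.Xt.2.1 cc.Xt.2.2 v).1 →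
      (k.p : ℤ) ^ N ∣ (killQ F.fd.base.a F.fd.base.b F.fd.base.c (k.zD F cc) cc.Xt.2.1 cc.Xt.2.2 v).2 → False := by
  simp

/-- Prepend one kill: its prime is prime (`by norm_num`) and its class carries a RESIDUE certificate there, by any
residue certificate shape (`killResidue_of_killCheck`, `killResidue_of_sig3Check`, `killResidue_of_sig2xCheck`, …).
[folklore] -/
theorem killResidueD_cons {k : ClKill} {ks : List ClKill} (hp : k.p.Prime)
    (h₁ : ∃ N : ℕ, ∀ v : ℤ × ℤ × ℤ × ℤ,
      ¬ ((k.p : ℤ) ∣ v.1 ∧ (k.p : ℤ) ∣ v.2.1 ∧ (k.p : ℤ) ∣ v.2.2.1 ∧ (k.p : ℤ) ∣ v.2.2.2) →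
      (k.p : ℤ) ^ N ∣ (killQ F.fd.base.a F.fd.base.b F.fd.base.c (k.zD F cc) cc.Xt.2.1 cc.Xt.2.2 v).1 →
      (k.p : ℤ) ^ N ∣ (killQ F.fd.base.a F.fd.base.b F.fd.base.c (k.zD F cc) cc.Xt.2.1 cc.Xt.2.2 v).2 → False)
    (h : ∀ k ∈ ks, k.p.Prime ∧ ∃ N : ℕ, ∀ v : ℤ × ℤ × ℤ × ℤ,
      ¬ ((k.p : ℤ) ∣ v.1 ∧ (k.p : ℤ) ∣ v.2.1 ∧ (k.p : ℤ) ∣ v.2.2.1 ∧ (k.p : ℤ) ∣ v.2.2.2) →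
      (k.p : ℤ) ^ N ∣ (killQ F.fd.base.a F.fd.base.b F.fd.base.c (k.zD F cc) cc.Xt.2.1 cc.Xt.2.2 v).1 →
      (k.p : ℤ) ^ N ∣ (killQ F.fd.base.a F.fd.base.b F.fd.base.c (k.zD F cc) cc.Xt.2.1 cc.Xt.2.2 v).2 → False) :
    ∀ k' ∈ k :: ks, k'.p.Prime ∧ ∃ N : ℕ, ∀ v : ℤ × ℤ × ℤ × ℤ,
      ¬ ((k'.p : ℤ) ∣ v.1 ∧ (k'.p : ℤ) ∣ v.2.1 ∧ (k'.p : ℤ) ∣ v.2.2.1 ∧ (k'.p : ℤ) ∣ v.2.2.2) →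
      (k'.p : ℤ) ^ N ∣ (killQ F.fd.base.a F.fd.base.b F.fd.base.c (k'.zD F cc) cc.Xt.2.1 cc.Xt.2.2 v).1 →
      (k'.p : ℤ) ^ N ∣ (killQ F.fd.base.a F.fd.base.b F.fd.base.c (k'.zD F cc) cc.Xt.2.1 cc.Xt.2.2 v).2 → False := by
  intro k' hk'
  rcases List.mem_cons.mp hk' with rfl | hm
  · exact ⟨hp, h₁⟩
  · exact h k' hm

/-- `killResidueD_cons` with the class representative supplied as an explicit literal `z` and the identity
`k.zD F cc = z` checked by the kernel (`by decide +kernel` in a row). [folklore] -/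
theorem killResidueD_cons_z {k : ClKill} {ks : List ClKill} (z : ℤ × ℤ × ℤ) (hz : k.zD F cc = z)
    (hp : k.p.Prime)
    (h₁ : ∃ N : ℕ, ∀ v : ℤ × ℤ × ℤ × ℤ,
      ¬ ((k.p : ℤ) ∣ v.1 ∧ (k.p : ℤ) ∣ v.2.1 ∧ (k.p : ℤ) ∣ v.2.2.1 ∧ (k.p : ℤ) ∣ v.2.2.2) →
      (k.p : ℤ) ^ N ∣ (killQ F.fd.base.a F.fd.base.b F.fd.base.c z cc.Xt.2.1 cc.Xt.2.2 v).1 →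
      (k.p : ℤ) ^ N ∣ (killQ F.fd.base.a F.fd.base.b F.fd.base.c z cc.Xt.2.1 cc.Xt.2.2 v).2 → False)
    (h : ∀ k ∈ ks, k.p.Prime ∧ ∃ N : ℕ, ∀ v : ℤ × ℤ × ℤ × ℤ,
      ¬ ((k.p : ℤ) ∣ v.1 ∧ (k.p : ℤ) ∣ v.2.1 ∧ (k.p : ℤ) ∣ v.2.2.1 ∧ (k.p : ℤ) ∣ v.2.2.2) →
      (k.p : ℤ) ^ N ∣ (killQ F.fd.base.a F.fd.base.b F.fd.base.c (k.zD F cc) cc.Xt.2.1 cc.Xt.2.2 v).1 →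
      (k.p : ℤ) ^ N ∣ (killQ F.fd.base.a F.fd.base.b F.fd.base.c (k.zD F cc) cc.Xt.2.1 cc.Xt.2.2 v).2 → False) :
    ∀ k' ∈ k :: ks, k'.p.Prime ∧ ∃ N : ℕ, ∀ v : ℤ × ℤ × ℤ × ℤ,
      ¬ ((k'.p : ℤ) ∣ v.1 ∧ (k'.p : ℤ) ∣ v.2.1 ∧ (k'.p : ℤ) ∣ v.2.2.1 ∧ (k'.p : ℤ) ∣ v.2.2.2) →
      (k'.p : ℤ) ^ N ∣ (killQ F.fd.base.a F.fd.base.b F.fd.base.c (k'.zD F cc) cc.Xt.2.1 cc.Xt.2.2 v).1 →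
      (k'.p : ℤ) ^ N ∣ (killQ F.fd.base.a F.fd.base.b F.fd.base.c (k'.zD F cc) cc.Xt.2.1 cc.Xt.2.2 v).2 → False := by
  subst hz
  exact killResidueD_cons hp h₁ h

/-- `Δ ≠ 0` is the first clause of `checkCD`. [folklore] -/
theorem deltaShort_ne_of_checkCD {r : ℕ} {ks : List ClKill} (hc : checkCD F cc r ks = true) :
    deltaShort cc.A cc.B cc.C ≠ 0 := by
  simp only [checkCD, Bool.and_eq_true, decide_eq_true_eq] at hc
  exact hc.1.1.1.1.1.1.1.1.1.1.1.1.1.1.1.1.1.1.1.1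

end Kit

section Rows

/-- **`K`-free door shape** (model `(0, A, 0, B, C)` read over `ℚ` from `ℤ`), in the exact shape of
`rank_eq_of_certsD` (kill hypothesis in residue form). [cite: Cassels1991LecturesEllipticCurves, §15]
[cite: CremonaAlgorithms1997, §3.6] -/
theorem sha_door_of_certsD (r : ℕ) (F : ClFieldCertDc) (cc : ClCurveCertD) (ks : List ClKill)
    (h2 : F.check2 = true) (hpr : F.fd.base.primeList.Forall Nat.Prime) (hc : checkCD F cc r ks = true)
    (hk : ∀ k ∈ ks, k.p.Prime ∧ ∃ N : ℕ, ∀ v : ℤ × ℤ × ℤ × ℤ,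
      ¬ ((k.p : ℤ) ∣ v.1 ∧ (k.p : ℤ) ∣ v.2.1 ∧ (k.p : ℤ) ∣ v.2.2.1 ∧ (k.p : ℤ) ∣ v.2.2.2) →
      (k.p : ℤ) ^ N ∣ (killQ F.fd.base.a F.fd.base.b F.fd.base.c (k.zD F cc) cc.Xt.2.1 cc.Xt.2.2 v).1 →
      (k.p : ℤ) ^ N ∣ (killQ F.fd.base.a F.fd.base.b F.fd.base.c (k.zD F cc) cc.Xt.2.1 cc.Xt.2.2 v).2 → False)
    (hlow : r ≤ (((⟨0, cc.A, 0, cc.B, cc.C⟩ : WeierstrassCurve ℤ)).map (Int.castRingHom ℚ)).mordellWeilRank) :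
    (((⟨0, cc.A, 0, cc.B, cc.C⟩ : WeierstrassCurve ℤ)).map (Int.castRingHom ℚ)).shaCorank 2 = 0 ∧
      AddCommGroup.primaryComponent (((⟨0, cc.A, 0, cc.B, cc.C⟩ : WeierstrassCurve ℤ)).map (Int.castRingHom ℚ)).sha 2 = ⊥ ∧
        (((⟨0, cc.A, 0, cc.B, cc.C⟩ : WeierstrassCurve ℤ)).map (Int.castRingHom ℚ)).mordellWeilRank = r := by
  haveI : Fact (Irreducible (MonicCubic.polyQ F.fd.base.a F.fd.base.b F.fd.base.c)) :=
    ⟨F.fd.base.irreducible_of_reg (F.fd.checkReg_of_coreD (F.fd.checkCoreD_of_checkD (F.checkD_of_check2 h2)))⟩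
  exact sha_door_map_of_door (fun h => sha_door_of_checkCD (K := CubicField F.fd.base.a F.fd.base.b F.fd.base.c) r F
      (CubicField.aeval_root _ _ _) (CubicField.finrank_eq _ _ _) h2 hpr cc ks hc hk h) hlow

/-- **`t₂(E) = 0 ∧ rank E(ℚ) = r` for the ORIGINAL model** `(a₁, a₂, a₃, a₄, a₆)` when the records certify its
completed-square model RESCALED by `d`, in the shape of `rank_eq_of_certsD_scaled`. [cite: CremonaAlgorithms1997, §3.6]
[cite: SilvermanAEC2009, III.3.1(b), Thm. X.4.2] -/
theorem shaCorank_two_eq_zero_of_certsD_scaled (r : ℕ) (F : ClFieldCertDc) (cc : ClCurveCertD) (ks : List ClKill)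
    (h2 : F.check2 = true) (hpr : F.fd.base.primeList.Forall Nat.Prime) (hc : checkCD F cc r ks = true)
    (hk : ∀ k ∈ ks, k.p.Prime ∧ ∃ N : ℕ, ∀ v : ℤ × ℤ × ℤ × ℤ,
      ¬ ((k.p : ℤ) ∣ v.1 ∧ (k.p : ℤ) ∣ v.2.1 ∧ (k.p : ℤ) ∣ v.2.2.1 ∧ (k.p : ℤ) ∣ v.2.2.2) →
      (k.p : ℤ) ^ N ∣ (killQ F.fd.base.a F.fd.base.b F.fd.base.c (k.zD F cc) cc.Xt.2.1 cc.Xt.2.2 v).1 →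
      (k.p : ℤ) ^ N ∣ (killQ F.fd.base.a F.fd.base.b F.fd.base.c (k.zD F cc) cc.Xt.2.1 cc.Xt.2.2 v).2 → False)
    (a₁ a₂ a₃ a₄ a₆ d : ℤ) (hd : d ≠ 0)
    (hABC : cc.A = d ^ 2 * (a₁ ^ 2 + 4 * a₂) ∧ cc.B = d ^ 4 * (8 * (a₁ * a₃ + 2 * a₄)) ∧
      cc.C = d ^ 6 * (16 * (a₃ ^ 2 + 4 * a₆)))
    (hlow : r ≤ (((⟨a₁, a₂, a₃, a₄, a₆⟩ : WeierstrassCurve ℤ)).map (Int.castRingHom ℚ)).mordellWeilRank) :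
    (((⟨a₁, a₂, a₃, a₄, a₆⟩ : WeierstrassCurve ℤ)).map (Int.castRingHom ℚ)).shaCorank 2 = 0 ∧
      (((⟨a₁, a₂, a₃, a₄, a₆⟩ : WeierstrassCurve ℤ)).map (Int.castRingHom ℚ)).mordellWeilRank = r := by
  haveI : Fact (Irreducible (MonicCubic.polyQ F.fd.base.a F.fd.base.b F.fd.base.c)) :=
    ⟨F.fd.base.irreducible_of_reg (F.fd.checkReg_of_coreD (F.fd.checkCoreD_of_checkD (F.checkD_of_check2 h2)))⟩
  exact shaCorank_two_transport_scaled a₁ a₂ a₃ a₄ a₆ d hd hABC (deltaShort_ne_of_checkCD hc)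
    (fun h => sha_door_of_checkCD (K := CubicField F.fd.base.a F.fd.base.b F.fd.base.c) r F
      (CubicField.aeval_root _ _ _) (CubicField.finrank_eq _ _ _) h2 hpr cc ks hc hk h) hlow

/-- The plain completed-square shape (`d = 1`), in the shape of `rank_eq_of_certsD_complSq`.
[cite: CremonaAlgorithms1997, §3.6] [cite: SilvermanAEC2009, Thm. X.4.2] -/
theorem shaCorank_two_eq_zero_of_certsD_complSq (r : ℕ) (F : ClFieldCertDc) (cc : ClCurveCertD) (ks : List ClKill)
    (h2 : F.check2 = true) (hpr : F.fd.base.primeList.Forall Nat.Prime) (hc : checkCD F cc r ks = true)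
    (hk : ∀ k ∈ ks, k.p.Prime ∧ ∃ N : ℕ, ∀ v : ℤ × ℤ × ℤ × ℤ,
      ¬ ((k.p : ℤ) ∣ v.1 ∧ (k.p : ℤ) ∣ v.2.1 ∧ (k.p : ℤ) ∣ v.2.2.1 ∧ (k.p : ℤ) ∣ v.2.2.2) →
      (k.p : ℤ) ^ N ∣ (killQ F.fd.base.a F.fd.base.b F.fd.base.c (k.zD F cc) cc.Xt.2.1 cc.Xt.2.2 v).1 →
      (k.p : ℤ) ^ N ∣ (killQ F.fd.base.a F.fd.base.b F.fd.base.c (k.zD F cc) cc.Xt.2.1 cc.Xt.2.2 v).2 → False)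
    (a₁ a₂ a₃ a₄ a₆ : ℤ)
    (hABC : cc.A = a₁ ^ 2 + 4 * a₂ ∧ cc.B = 8 * (a₁ * a₃ + 2 * a₄) ∧ cc.C = 16 * (a₃ ^ 2 + 4 * a₆))
    (hlow : r ≤ (((⟨a₁, a₂, a₃, a₄, a₆⟩ : WeierstrassCurve ℤ)).map (Int.castRingHom ℚ)).mordellWeilRank) :
    (((⟨a₁, a₂, a₃, a₄, a₆⟩ : WeierstrassCurve ℤ)).map (Int.castRingHom ℚ)).shaCorank 2 = 0 ∧
      (((⟨a₁, a₂, a₃, a₄, a₆⟩ : WeierstrassCurve ℤ)).map (Int.castRingHom ℚ)).mordellWeilRank = r := by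
  haveI : Fact (Irreducible (MonicCubic.polyQ F.fd.base.a F.fd.base.b F.fd.base.c)) :=
    ⟨F.fd.base.irreducible_of_reg (F.fd.checkReg_of_coreD (F.fd.checkCoreD_of_checkD (F.checkD_of_check2 h2)))⟩
  exact shaCorank_two_transport_complSq a₁ a₂ a₃ a₄ a₆ hABC (deltaShort_ne_of_checkCD hc)
    (fun h => sha_door_of_checkCD (K := CubicField F.fd.base.a F.fd.base.b F.fd.base.c) r F
      (CubicField.aeval_root _ _ _) (CubicField.finrank_eq _ _ _) h2 hpr cc ks hc hk h) hlow

/-- Door plumbing for a curve already given by a plain model (`a₁ = a₃ = 0`), in the shape of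
`rank_eq_of_certsD_plain`. [cite: Cassels1991LecturesEllipticCurves, §15] -/
theorem sha_door_of_certsD_plain (r : ℕ) (F : ClFieldCertDc) (cc : ClCurveCertD) (ks : List ClKill)
    (h2 : F.check2 = true) (hpr : F.fd.base.primeList.Forall Nat.Prime) (hc : checkCD F cc r ks = true)
    (hk : ∀ k ∈ ks, k.p.Prime ∧ ∃ N : ℕ, ∀ v : ℤ × ℤ × ℤ × ℤ,
      ¬ ((k.p : ℤ) ∣ v.1 ∧ (k.p : ℤ) ∣ v.2.1 ∧ (k.p : ℤ) ∣ v.2.2.1 ∧ (k.p : ℤ) ∣ v.2.2.2) →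
      (k.p : ℤ) ^ N ∣ (killQ F.fd.base.a F.fd.base.b F.fd.base.c (k.zD F cc) cc.Xt.2.1 cc.Xt.2.2 v).1 →
      (k.p : ℤ) ^ N ∣ (killQ F.fd.base.a F.fd.base.b F.fd.base.c (k.zD F cc) cc.Xt.2.1 cc.Xt.2.2 v).2 → False)
    (a₂ a₄ a₆ : ℤ) (hABC : cc.A = a₂ ∧ cc.B = a₄ ∧ cc.C = a₆)
    (hlow : r ≤ (((⟨0, a₂, 0, a₄, a₆⟩ : WeierstrassCurve ℤ)).map (Int.castRingHom ℚ)).mordellWeilRank) :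
    (((⟨0, a₂, 0, a₄, a₆⟩ : WeierstrassCurve ℤ)).map (Int.castRingHom ℚ)).shaCorank 2 = 0 ∧
      AddCommGroup.primaryComponent (((⟨0, a₂, 0, a₄, a₆⟩ : WeierstrassCurve ℤ)).map (Int.castRingHom ℚ)).sha 2 = ⊥ ∧
        (((⟨0, a₂, 0, a₄, a₆⟩ : WeierstrassCurve ℤ)).map (Int.castRingHom ℚ)).mordellWeilRank = r := by
  haveI : Fact (Irreducible (MonicCubic.polyQ F.fd.base.a F.fd.base.b F.fd.base.c)) :=
    ⟨F.fd.base.irreducible_of_reg (F.fd.checkReg_of_coreD (F.fd.checkCoreD_of_checkD (F.checkD_of_check2 h2)))⟩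
  exact sha_door_transport_plain a₂ a₄ a₆ hABC
    (fun h => sha_door_of_checkCD (K := CubicField F.fd.base.a F.fd.base.b F.fd.base.c) r F
      (CubicField.aeval_root _ _ _) (CubicField.finrank_eq _ _ _) h2 hpr cc ks hc hk h) hlow

end Rows

end Summit.BirchSwinnertonDyer.BirchSwinnertonDyer.Theorems.ShaPrimaryTransferSelmerCubicCover

end
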